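import Mathlib
import HarnessLib
import HarnessLib.Audit
import Summits.AtomisticToContinuum.Statement

/-!
Route: RingSparseCollisionForest

CLOSED (retired) 2026-08-15T13:46:03Z by operator:999:1257524 — reason: not-a-thesis: assembly does not conclude the sub-problem Statement — note: D-0027 §2.1 audit (human 2026-08-15: routes that do not decide the summit are removed): the assembly concludes `Literature.MathematicalPhysics.KineticTheory.HydrodynamicLimit`, not the sub-problem statement; a NEW conforming route may be opened from the same idea (generated `closes : … → _root_.Hydr. The file is kept as the record of this route; refuted decls are indexed as negative knowledge (`ledger negatives`).

# Route RingSparseCollisionForest — ring density of the collision forest certifies contact chaos;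
chaos in the dilute band closes hs-Euler

It suffices to show X = RingSparsity ∧ RingDensityLaw ∧ RingCertificate ∧ ChaosClosure ∧
DiluteSelfConsistency, realising card
ring-sparse-collision-forest (spine) in its CERTIFICATE form. Along one deterministic trajectory
form the time-ordered collision
multigraph; a collision (i,j) at time s is an M-RING if the backward clusters of i and j over the
preceding window of M local kinetic
time units intersect (a cycle closes), else M-FRESH. RingSparsity: in the dilute band ρ_t(x)σ³ <
η(M,δ) the cell/window ring FRACTION is
≤ δ in probability along the local-Gibbs-started flow (small data: extensive equilibrium large
deviation + Cauchy–Schwarz transfer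
against the invariant Gibbs law — filed provable supports). RingDensityLaw: the ring fraction
converges in probability to its EQUILIBRIUM
value at the local Euler state. RingCertificate (the quasi-randomness bet, Chung–Graham–Wilson
"few/normal short cycles ⇒ uniform edge
statistics" for collision forests): RingSparsity → RingDensityLaw → ContactChaos, where the typed
target ContactChaos is the EMPIRICAL
Stosszahlansatz in Enskog form — the law of (v⁻, v*⁻, ω) over collisions in a mesoscopic cell/window
equals the flux-biased product of the
cell's empirical velocity law, and the collision count equals the Enskog rate with contact factor
(Z(η)−1)/((2π/3)η) of the empirical
local reduced density, both in probability. ChaosClosure: ContactChaos → HydroLimitInBand (H-theorem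
+ conservation laws + hs entropy
inequality + weak–strong uniqueness, inside the packing band). DiluteSelfConsistency (shared with
route ImplosionLoophole, stmt 3091) lifts
the band-guarded conjunct (HydroLimitInBand, stmt 3093, inlined in ChaosClosure) to the conjunct by
quantifier bookkeeping. Ranks: 2 RingDensityLaw (the absolute, MD-falsifiable premise), 3
RingSparsity (the provable-for-small-data tree-likeness theorem), 4 RingCertificate (the novel
rigidity bet, moot without its premises), 5 ChaosClosure, 6 DiluteSelfConsistency.
Lean: `RingSparsity ∧ RingDensityLaw ∧ RingCertificate ∧ ChaosClosure ∧ DiluteSelfConsistency`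

## Assembly
Pure logic, sorry-free in the planner's Sketch.lean (`assembly_holds`, axioms
propext/Classical.choice/Quot.sound): from RingSparsity and
RingDensityLaw, RingCertificate yields ContactChaos; ChaosClosure turns it into HydroLimitInBand;
DiluteSelfConsistency supplies the
packing band for every admissible classical solution, and the quantifier bookkeeping (η₀ from
HydroLimitInBand, σ₀ = min of the two)
gives HydrodynamicLimit profile by profile (`chaosClosure_iff : ChaosClosure ↔ (ContactChaos →
HydroLimitInBand)` is `Iff.rfl` against the verbatim 3093 text). A prover closes item 1 by copying
`bookkeeping` + `assembly_of_bookkeeping` from the sketch.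

Rationale: WHY THIS LINE. The mechanism is combinatorial: make the COLLISION FOREST of a single trajectory the
object and use the density of its short cycles
(rings) as a certificate for molecular chaos, exactly as the C₄ count certifies uniform edge
distribution in quasi-random graphs
(ChungGrahamWilson1989; sparse version ChungGraham2002) — here paid for in equilibrium currency: the
ring count is an extensive
observable whose Gibbs large deviations (dependency-graph concentration, Janson2004) transfer to the
non-equilibrium flow by ONE
Cauchy–Schwarz against the invariant law, with no mixing input and globally in time. Backward
clusters are the object of AokiEtAl2015
(Thm 1: e^{C̃t}−1 ≤ ⟨K⟩_t ≤ C₂(e^{C₁t}−1), Boltzmann–Grad) and PulvirentiSimonella2021; recollision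
bookkeeping is the core of
Lanford-type proofs (Lanford1975, GST2013, PulvirentiSimonella2016, BGSSAnnals2023) and of
DengHaniMa2024's long-time cutting algorithm —
all at Boltzmann–Grad, where rings VANISH; at fixed σ they are a positive minority and the planning
found that the card's naive form
("fresh collisions are product-like, rings unbiased") is false already at equilibrium (ring
sub-populations are velocity-biased by the
conditioning on ancestry), so every statement here is RELATIVE TO LOCAL EQUILIBRIUM and exact as N →
∞ at fixed σ (defects O(Kn),
Lutsko1996), never an iterated σ → 0 limit (DiluteRegime barrier). Imported areas:
extremal/quasi-random graph theory (certificate by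
cycle density), large deviations for Gibbs fields, kinetic theory of dense gases (Enskog contact
factor from the virial theorem,
VanbeijerenErnst1973, Resibois1978). What it does that the seven open routes do not: no
entropy/ergodicity classification
(RelEntropyErgodic, ChaoticMixing, VanishingNoise), no hierarchy or cumulant expansion summed over
Euler times (DenseKineticExpansion —
nothing is expanded in density or time here), no PDE-side selection alone (DissipativeWeakStrong),
no one-particle response
(OneParticleInfluence); it files the first TYPED empirical-Stosszahlansatz waypoint (ContactChaos)
of the board and docks explicitly into
ImplosionLoophole's packing band (HydroLimitInBand 3093, DiluteSelfConsistency 3091) instead of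
hiding the density-blow-up issue.

RANKED CRUXES. #0 ContactChaos (target) — EMPIRICAL ENSKOG CHAOS ALONG THE FLOW (typed waypoint the
cruxes aim at): ∃ η₀ > 0 such that for all continuous positive profiles ∃ σ₀, for σ < σ₀, every
window multiplier M > 0, every classical hs-Euler solution on [0,T) staying in the packing band
ρ_t(x)σ³ < η₀, every flow family with the LLN at t = 0, every t < T and δ > 0 there is h₀ with: for
cells B(x₀,h), h < h₀, and the window [t, t + w_N], w_N = M/(σ²ρ_t(x₀)√θ_t(x₀)(N+1)^{1/3}) (M local
kinetic time units), (SEL+ANG) for every continuous |F| ≤ 1 on V3³ the collision-sampled average of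
F(v_i⁻, v_j⁻, ω_ij) (incoming velocities = left limits, ω = ε⁻¹·sepVec) over ordered collisions with
x_i in the cell differs from the flux-biased all-pairs average Σ_{i≠j in cell} ∫
F(v_i,v_j,ŷ)((v_i−v_j)·y)₋e^{−|y|²}dy (normalised) by more than δ with probability → 0 as N → ∞;
(RATE) the ordered collision count differs from the Enskog prediction Σ_{i≠j in cell} πε_N²|v_i−v_j|
w_N g_E(n_cell σ³)/|cell|, g_E(η) = (Z(η)−1)/((2π/3)η) with Z = hsCompressibility and n_cell the
empirical normalised density, by more than a factor δ with probability → 0. This is the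
(ANG)+(SEL)+rate input singled out by cards limit-collision-measure-chaos / angles-are-not-enough,
typed. (why it might fail: Persistent O(1) velocity–position pattern at the free-path scale not of
ring origin (streaming lanes in strong shear) or a contact pair density ≠ g_E(local η) out of
equilibrium would break SEL or RATE at fixed σ; at finite N both defects are O(Kn) (Lutsko1996).)
[Lutsko1996, doi:10.1007/bf01029065, VanbeijerenErnst1973, Resibois1978, Spohn1991, CIP1994]
#2 RingDensityLaw (crux) — RING FRACTION TAKES ITS EQUILIBRIUM VALUE ALONG THE FLOW: ∃ η₀ > 0, for
all profiles ∃ σ₀, for σ < σ₀, M > 0, band-respecting classical solutions, flows with LLN at 0, t ∈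
(0,T), δ > 0 ∃ h₀: for h < h₀, x₀ and every comparison flow family Ψ of N+1 spheres with diameter
parameter σ' = σρ_t(x₀)^{1/3} (same reduced density as the cell), P(|Z_ring − r_E(N)·Z_coll| > δ
Z_coll) → 0, where Z_coll/Z_ring count ordered (ring) collisions in cell×window (M-rings: backward
clusters over (s − w_N, s) intersect; clusters = time-respecting collision chains, AokiEtAl2015 §1)
and r_E(N) = E_Q[Z'_ring]/E_Q[Z'_coll] is the ring fraction of the HOMOGENEOUS equilibrium system
(canonical law, density 1, temperature θ_t(x₀), diameter σ', window [0, w'_N] with the same number M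
of kinetic units). 'Rings out of equilibrium are as frequent as rings in equilibrium at the same
local state' — the quantitative half of the certificate, MD-measurable. [difficulty: XL] (why it
might fail: A non-equilibrium bias in WHO recollides (compression/shear changing re-aiming geometry
at the free-path scale) shifts the ring fraction at O(1)·(Kn-independent) if local equilibrium fails
at scale ℓ; also needs h → 0 after N → ∞ (gradient mixing) and the equilibrium expectations to
stabilise in N.) [AokiEtAl2015, PulvirentiSimonella2021, Dorfman1999, Cohen1967, BGSSCPAM2023]
#3 RingSparsity (crux) — TREE-LIKENESS OF NON-EQUILIBRIUM COLLISION HISTORIES (card B1, all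
amplitudes): for every window multiplier M > 0 and δ > 0 there is a packing threshold η(M,δ) > 0
such that for all profiles ∃ σ₀, for σ < σ₀, every classical solution with ρ_t(x)σ³ < η on [0,T),
flows with LLN at 0, t ∈ (0,T), h > 0, x₀: P(Z_ring > δ·Z_coll in B(x₀,h) × [t, t+w_N]) → 0 as N → ∞
(w_N = M local kinetic units as in ContactChaos). Small data: EquilibriumRingLD + TiltTransfer +
HomogeneousInvariance give it for ALL times (support SmallDataRingSparsity); large data: zoom (card
first-failure-blowup) or a super-extensive LD for the time-integrated ring count (card
spacetime-superextensive-ld). [difficulty: L] (why it might fail: Large data: the transfer constant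
e^{ΛN} of the initial tilt beats the extensive equilibrium rate e^{−c(δ,M)N} unless the amplitude is
small; clusters grow like e^{C M} (AokiEtAl2015 Thm 1) so η(M,δ) ~ δe^{−2CM} is tiny; a
flow-generated excess of recollisions at fixed packing would refute it.) [AokiEtAl2015,
PulvirentiSimonella2021, Janson2004, KipnisLandim1999, BGSSAnnals2023]
#4 RingCertificate (crux) — RING DENSITY CERTIFIES CHAOS (card's programme form, CGW-type rigidity
for time-ordered collision forests): in the sparse regime (RingSparsity) equality of the window ring
fraction with its equilibrium value at the local state (RingDensityLaw) forces the empirical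
Stosszahlansatz (ContactChaos). Intended mechanism: ancestry lemma (at fresh collisions incoming
data come from disjoint backward clusters, so correlation can only be inherited from the mesoscopic
far field at the window start) + 'excess correlation forces excess/deficient short cycles' (codegree
⇒ edge uniformity, ChungGrahamWilson1989 Thm 1 analogue; sparse setting ChungGraham2002) +
rings-in-a-local-equilibrium-medium for the ring minority; flag-algebra/SDP certificates over motifs
with ≤ 4 collisions as the systematic search tool. [deps: RingSparsity, RingDensityLaw,
ContactChaos] [difficulty: open-problem] (why it might fail: No Cauchy–Schwarz/Gram identity is
known for time-ordered collision motifs: a velocity-correlated state with EQUILIBRIUM ring density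
may exist (e.g. shear-aligned pairs), making the certificate blind; the far-field input (off-contact
k-body LE) is itself open at fixed σ.) [ChungGrahamWilson1989, ChungGraham2002, AokiEtAl2015,
PulvirentiSimonella2016, BGSSAnnals2023, Lutsko1996]
#5 ChaosClosure (crux) — EMPIRICAL ENSKOG CHAOS CLOSES hs-EULER IN THE PACKING BAND: ContactChaos →
HydroLimitInBand, the packing-guarded conjunct of route ImplosionLoophole
(stmt-AtomisticToContinuum-3093, inlined verbatim as the consequent: ∃ η₀ > 0 ∀ profiles ∃ σ₀ ∀ σ <
σ₀ ∀ classical solutions with ρ_t(x)σ³ < η₀ on [0,T) ∀ flows, LLN at 0 ⇒ LLN at every t < T).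
Intended proof: Bogolyubov's exact empirical identity for (μ^N, collision measure)
(doi:10.1007/bf01029065) + SEL/ANG/RATE ⇒ empirical revised-Enskog structure in every cell/window ⇒
H-theorem (Resibois1978) ⇒ cell velocity laws relax to local Maxwellians within O(1) kinetic times
and entropy production ≥ 0 ⇒ kinetic + collisional fluxes = (ρu⊗u + ρθZ(ρσ³)𝟙, (E+p)u) and the hs
entropy inequality for limit points ⇒ dissipative measure-valued solution ⇒ relative-entropy
weak–strong uniqueness (Dafermos1979, BrezinaFeireisl2018, HsEntropyConvex 0817) ⇒ fields converge
for t < T; velocity tails by transfer of Gaussian moments against the invariant law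
(TiltTransfer-type bound). [deps: ContactChaos] [difficulty: XL] (why it might fail: Chaos tested by
bounded F in shrinking cells may be too weak for a quantitative H-theorem on EMPIRICAL measures
(atomic measures have no entropy: smoothing + Cercignani-type production bounds,
DesvillettesVillani2005); mv limits need the exact hs entropy inequality.) [Resibois1978,
BrezinaFeireisl2018, Dafermos1979, DesvillettesVillani2005, Spohn1991, doi:10.1007/bf01029065,
Lachowicz1998]
#6 DiluteSelfConsistency (crux) — (shared verbatim with route ImplosionLoophole,
stmt-AtomisticToContinuum-3091) for every η > 0 and all continuous positive profiles ∃ σ₀ such that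
for σ < σ₀ every classical hs-Euler solution on [0,T) whose t = 0 fields are the LLN limit of the
local Gibbs laws keeps packing ρ_t(x)σ³ < η on [0,T) × 𝕋³. Load-bearing here only to lift
HydroLimitInBand to the conjunct (bookkeeping proved in Sketch.lean: `bookkeeping`,
`assembly_holds`). [difficulty: open-problem] (why it might fail: DenseExcursion (ImplosionLoophole
rank 2: shock-free γ=5/3 implosion tracked by the σ-family, CaolaboraEtAl2025) refutes it outright;
even if true it is a σ-uniform density bound at the first singularity for ALL smooth data.)
[CaolaboraEtAl2025, MerleEtAl2022, Sideris1985, Spohn1991]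
#9 EquilibriumRingLD (support) — EXTENSIVE EQUILIBRIUM LARGE DEVIATIONS FOR THE RING FRACTION (card
B1(a)): for θc > 0, M > 0, δ > 0 ∃ σ₀, for σ < σ₀ and h > 0 ∃ C > 0 such that under the homogeneous
canonical law Q_N (activity 1, velocity 0, temperature θc) of N+1 spheres, for every t, x₀, flow
family and N: Q_N(|Z_ring − r_E(N) Z_coll| > δ Z_coll in B(x₀,h) × [t, t+w_N]) ≤ C e^{−(N+1)/C},
r_E(N) = E_Q[Z_ring]/E_Q[Z_coll], w_N = M/(σ²√θc (N+1)^{1/3}). Proof sketch: velocity truncation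
(Gaussian tails), spatial near-independence of mesoscopic sub-cells over a microscopic window +
dependency-graph Bernstein/Janson bound inside, canonical-constraint decoupling; stationarity makes
C independent of t (HomogeneousInvariance). [difficulty: M] [Janson2004, KipnisLandim1999,
Ruelle1969, AokiEtAl2015]
#9 TiltTransfer (support) — CAUCHY–SCHWARZ TRANSFER AGAINST THE INVARIANT LAW (card B4): for σ > 0,
continuous positive profiles (a₀,u₀,θ₀) and θc with θ₀ < 2θc pointwise there is Λ such that for all
N, flows Φ, times t and measurable B: (lawAt Φ P_N t)(B) ≤ e^{Λ(N+1)} · Q_N(B)^{1/2}, P_N =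
localGibbsLaw σ a₀ u₀ θ₀ N Φ, Q_N = homogeneous law (1, 0, θc). Proof: P_t(B) = ∫ 1_B∘Φ_t · (dP/dQ)
dQ ≤ Q(Φ_t⁻¹B)^{1/2} ‖dP/dQ‖_{L²(Q)}, invariance of Q (HomogeneousInvariance), ‖dP/dQ‖² ≤
(Z_Q/Z_P²)·K^{N+1} with K = sup_x ∫ (a₀M_{u₀,θ₀})²/M_{0,θc} dv < ∞ iff θ₀ < 2θc, Z_P ≥ (inf a₀ ·
c_v)^{N+1} Z_Q; both sides vanish when the partition function does. [difficulty: provable-now]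
[KipnisLandim1999, Spohn1991, GST2013]
#9 HomogeneousInvariance (support) — (shared verbatim with route OneParticleInfluence,
stmt-AtomisticToContinuum-3073) the canonical law with constant profiles is invariant under every
hard-sphere flow: lawAt Φ p t = p (Liouville preservation, energy and momentum conservation along
trajectories, invariance of the good set). [difficulty: provable-now] [GST2013, CIP1994,
Alexander1975]
#9 SmallDataRingSparsity (support) — SMALL-DATA TREE-LIKENESS FOR ALL TIMES (card B1(a)+(b), the
concrete deliverable): for c, θc > 0, M > 0, δ > 0 ∃ σ₀, for σ < σ₀ ∃ η₀ > 0 such that for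
continuous positive profiles within η₀ of the constants (|a₀−c|, ‖u₀‖, |θ₀−θc| ≤ η₀), every flow
family, EVERY time t ∈ ℝ, h > 0, x₀: P_N(Z_ring > δ Z_coll in B(x₀,h) × [t, t+w_N]) → 0, w_N =
M/(σ²√θc(N+1)^{1/3}). From EquilibriumRingLD (+ smallness of r_E: r_E(N) ≤ δ/2 for σ < σ₀(M,δ), an
Enskog-level three-body re-aiming computation, Dorfman1999 §16) and TiltTransfer with Λ(η₀) <
1/(2C): a rigorous dynamical statement at fixed density valid for all macroscopic times with no
mixing input. [difficulty: M] [Janson2004, KipnisLandim1999, AokiEtAl2015, Dorfman1999]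

TWO-LAYER PLAN. Foreseen glued splits (k ≤ 3, depth 1; nothing filed now): RingCertificate ⇐
FarFieldToFresh (ancestry lemma: off-contact k-body local
equilibrium at the window start ⇒ fresh-collision statistics equal their equilibrium counterparts) →
RingsInLEMedium (3–4-body recollision
events completed within M kinetic units in a medium whose fields vary by O(Kn) have equilibrium
statistics) → RingCertificate.
ChaosClosure ⇐ EmpiricalHTheorem (cell Maxwellianisation + entropy production from SEL/ANG/RATE) →
FluxAndEntropyClosure (dissipative
mv solution with the hs EOS and entropy) → weak–strong uniqueness (BrezinaFeireisl2018-type with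
HsEntropyConvex 0817) → ChaosClosure.
RingSparsity ⇐ SmallDataRingSparsity (support, all times) → LargeDataLift (zoom of
first-failure-blowup, or time-integrated super-extensive
LD) → RingSparsity. SmallDataRingSparsity ⇐ EquilibriumRingLD → EquilibriumRingDensitySmall (r_E ≤
C_M σ³) → TiltTransfer.

KILL CRITERIA. ¬RingCertificate by an explicit balanced, ring-normal but non-chaotic family (a
scheduled pair-selection state in the spirit of card
angles-are-not-enough Prop A, realised dynamically, or MD showing equilibrium ring density with an
O(1) SEL defect) closes the route
`refuted:RingCertificate` — the certificate idea is dead, RingSparsity/SmallDataRingSparsity survive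
as stand-alone tree-likeness theorems.
¬RingDensityLaw (MD or theory: ring fraction along sheared/compressed local-Gibbs runs ≠ equilibrium
value at equal local state, persisting as
N grows) forces a pivot to the one-sided certificate (ring EXCESS only) or closes the route.
¬RingSparsity at small amplitude contradicts
EquilibriumRingLD + TiltTransfer — would be major news (check the LD first). ¬ContactChaos kills
every kinetic-flavoured line on the board,
not only this one; record as summit-level negative. DenseExcursion proved (route ImplosionLoophole)
refutes DiluteSelfConsistency: this
route goes BROKEN together with the conjunct's audit premise; repair = restate the Assembly to end
in HydroLimitInBand pending the
operator's re-ruling. L2HydroFields/HydroLimitInBand proved elsewhere moots ChaosClosure but not the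
certificate cruxes.

NOT DECOMPOSED YET. The ancestry lemma and the far-field (off-contact k-body) local-equilibrium
statement it consumes; the equilibrium three-body computation
of r_E (Enskog-level re-aiming integral) and its N-stability; the flag-algebra/SDP certificate
search over ≤ 4-collision motifs (kit job,
card B5); the large-data lift of RingSparsity; every constant (η(M,δ) ~ δe^{−2CM}, C of the LD, Λ of
the tilt); velocity-tail control
inside ChaosClosure; d = 3 only; the time-symmetric variant of 'ring' (backward ∪ forward clusters)
that an entropy argument may prefer.
All are layer-2 children or prover-side lemmas (--supports).

CHEAPEST FALSIFIER. Event-driven MD at packing 0.02–0.1, N = 10⁵–10⁶, Kolmogorov shear and a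
pre-shock compression wave from local-Gibbs data: measure per
cell/window (i) the M-ring fraction vs the equilibrium run at equal (η, θ) — RingDensityLaw predicts
agreement to o(1), RingSparsity
predicts ≤ C_M η; (ii) the SEL/ANG two-sample distance between collision-sampled (v⁻, v*⁻, ω) and
the flux-biased all-pairs law, and the
collision count vs the Enskog prediction — ContactChaos predicts defects ∝ Kn = N^{-1/3}; (iii) the
decisive one for THIS route: bin cells
by ring-fraction deviation and by SEL defect — RingCertificate predicts no cell population with
normal ring density but O(1) SEL defect.
Analytic cheapest check: compute the velocity bias of the 3-body single-recollision sub-population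
at equilibrium (it is O(1), confirming
that only the relative-to-equilibrium statements filed here can be true). Lookup: a CGW-type theorem
for temporal/geometric graphs
(searched: none found). Galaxy broad search was saturated at filing (logged); crossref/arXiv
searches listed under Novelty.

NUMBERS. Fixed reduced density (N+1)ε³ = σ³; Kn ≍ (N+1)^{-1/3}; window w_N = M/(σ²ρ√θ(N+1)^{1/3}) =
M local kinetic units, M = 1 ≈ √2·π·ρ·v̄ ≈
4.4ρ√θ mean free times at unit normalised density; collisions in a cell of radius h per window ≍ N
h³ M → ∞. Backward-cluster size over
M kinetic units: e^{C̃M} − 1 ≤ ⟨K⟩ ≤ C₂(e^{C₁M} − 1) at Boltzmann–Grad (AokiEtAl2015 Thm 1,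
MD-confirmed §5), so the equilibrium ring
fraction is r_E ≈ C e^{2CM}·η at packing-type parameter η = ρσ³ (leading events: 3-body single
recollision, Dorfman–Cohen; Cohen1967
§2 (11a)–(14)); Enskog contact factor g_E(η) = (Z(η) − 1)/((2π/3)η) = 1 + O(η) (Z = 1 + (2π/3)η + …,
HsEosLowDensity 0768). Transfer:
P_t(B) ≤ e^{Λ(N+1)} Q(B)^{1/2} is useful iff the equilibrium cost c(δ,M) > 2Λ; Λ = O(amplitude).
SEL/ANG/LE defects at finite N: O(φ·Kn),
O(φ·Kn), O(Kn) (card angles-are-not-enough §3; Lutsko1996: contact velocity correlations ∝ shear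
rate). Items at open: 11 (1 target,
5 cruxes of which 1 shared, 4 supports of which 1 shared, 1 assembly); all typed; Sketch.lean rc 0.

DEFINITION REQUESTS. None filed now: backward clusters, M-ring collisions, cell/window collision
counts and the flux-biased reference functional are INLINED
as `let`s in each item (self-contained Props over Literature.Analysis.FluidPDE.{HardSphereFlow,
contactSet, Torus.geometry, Torus.euclidDist},
Function.leftLim, finsum). If a grounder prefers named notions, the natural requests are
`collisionForest` / `backwardCluster` /
`IsRingCollision` under topic Literature/MathematicalPhysics/KineticTheory (AokiEtAl2015 §1
definition), after which the items can be
restated verbatim-shorter. No cite facts requested (AokiEtAl2015 Thm 1 is Boltzmann–Grad and would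
not discharge anything here).

Novelty: Searches (2026-08-15): `lit frontier AtomisticToContinuum --since 2020` (30 rows: DHM follow-ups
arXiv:2602.04407, Rayleigh-gas cumulants
arXiv:2605.19696, binary-collision moderate deviations doi:10.1007/s10955-026-03570-w — all
Boltzmann–Grad/stochastic; nothing on
collision-graph cycle statistics at fixed density); `lit bridges AtomisticToContinuum --cross any`
(30 rows; no graph-theoretic bridge);
`lit search --source crossref "backward clusters hard sphere system low density Pulvirenti
Simonella"` (10: doi:10.1142/s0218202515500256 =
AokiEtAl2015 READ arXiv:1408.6571 pp.1–3, 7–9, Thm 1 + MD §5; doi:10.3934/dcds.2021021 =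
PulvirentiSimonella2021; doi:10.1007/s00222-016-0682-4
= PulvirentiSimonella2016; doi:10.1007/s10955-013-0905-7); `lit search --source crossref "molecular
chaos pre-collisional velocity
correlations hard sphere fluid shear"` (10: doi:10.1103/physrevlett.77.2225 = Lutsko1996,
doi:10.1080/00268970110109934 Dufty 2002);
`lit search --source crossref "microscopic solutions Boltzmann-Enskog equation empirical measure
hard spheres"` (6: doi:10.1007/bf01029065
Bogolyubov 1975, doi:10.3934/krm.2014.7.755 Trushechkin 2014); `lit cite` of doi:10.1007/bf02125347
(ChungGrahamWilson1989),
doi:10.1007/s004930200010 (ChungGraham2002), doi:10.1002/rsa.20008 (Janson2004); `lit galaxy search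
"recollisions hard spheres molecular chaos
ring collisions" --star all` (service saturated at filing, logged; the card's own galaxy searches
found noise only); the 135 cards and 7
rou  [refs: 10.1007/s10955-026-03570-w, 10.1142/s0218202515500256, 10.3934/dcds.2021021, 10.1007/s00222-016-0682-4, 10.1007/s10955-013-0905-7, 10.1103/physrevlett.77.2225, 10.1080/00268970110109934, 10.1007/bf01029065, 10.3934/krm.2014.7.755, 10.1007/bf02125347, 10.1007/s004930200010, 10.1002/rsa.20008, 2602.04407, 2605.19696, 1408.6571, doi:10.1007/s10955-026-03570-w, doi:10.1142/s0218202515500256, doi:10.39]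

Barriers (technique_class: quasi-randomness collision-graph ld-transfer): - technique_class: quasi-randomness collision-graph ld-transfer
- Literature.Barriers.AtomisticToContinuum.NoDensityExpansionBarrier: engaged in spirit (rings are
its leading events) but not in its technique class: nothing is expanded in density or time and no
transport coefficient appears (Euler order); rings are COUNTED over windows of M = O(1) kinetic
units (the convergent, few-mean-free-time part of Cohen's expansion, scope caveat (d)), and their
contribution is required only to match local equilibrium (RingDensityLaw / ContactChaos), never
resummed; the bet is that the certificate step needs no term-by-term control of histories longer
than M.
- Literature.Barriers.AtomisticToContinuum.DiluteRegimeBarrier: evaded in form and substance — σ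
fixed, no Boltzmann–Grad or iterated σ → 0 limit; the planning explicitly rejected the card's "∀δ
∃σ₀" forms that would have smuggled an iterated limit; Boltzmann–Grad cluster results (AokiEtAl2015)
enter only as the calibration of r_E and of η(M,δ).
- Literature.Barriers.AtomisticToContinuum.BoltzmannHypothesisBarrier: no entropy method and no
classification of stationary states of the infinite system; the closure input is the typed empirical
Stosszahlansatz ContactChaos, which visibly FAILS for the barrier's ideal-gas kernel (no collisions
⇒ RATE clause false, ballistic memory) — consistent, nothing refuted is re-wanted.
- Literature.Barriers.AtomisticToContinuum.HighMomentumCutoffBarrier: not in its class (no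
relative-entropy Gronwall

History (route lifecycle, newest last):
- 2026-08-15T13:46:03Z · CLOSED retired — not-a-thesis: assembly does not conclude the sub-problem Statement (operator:999:1257524)

sub-problem: HydrodynamicLimit · status: closed(retired) · opened planner-plancard-AtomisticToContinuum-Hydrody-a230b4b5-0 2026-08-15T11:49:03Z · rev 0 · ledger route-AtomisticToContinuum-RingSparseCollisionForest
GENERATED by the gate from the ledger (D-0016/17). Provers cite these decls: `theorem foo : Summit.AtomisticToContinuum.HydrodynamicLimit.Theses.RingSparseCollisionForest.<Decl> := …` in Summits/AtomisticToContinuum/HydrodynamicLimit/Theorems/<Name>.lean.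
-/

namespace Summit.AtomisticToContinuum.HydrodynamicLimit.Theses.RingSparseCollisionForest

open scoped BigOperators Topology Manifold Classical MeasureTheory ProbabilityTheory Matrix InnerProductSpace ComplexConjugate ContinuousMap
open Filter Set Function TopologicalSpace MeasureTheory

attribute [summit_statement] _root_.HydrodynamicLimit

/-- item stmt-AtomisticToContinuum-6614 · target · rank 0 · closed · moot by None · by planner
why it might fail: Persistent O(1) velocity–position pattern at the free-path scale not of ring origin (streaming lanes in strong shear) or a contact pair density ≠ g_E(local η) out of equilibrium would break SEL or RATE at fixed σ; at finite N both defects are O(Kn) (Lutsko1996).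
sources: Lutsko1996, doi:10.1007/bf01029065, VanbeijerenErnst1973, Resibois1978, Spohn1991, CIP1994
[target] EMPIRICAL ENSKOG CHAOS ALONG THE FLOW (typed waypoint the cruxes aim at): ∃ η₀ > 0 such
that for all continuous positive profiles ∃ σ₀, for σ < σ₀, every window multiplier M > 0, every
classical hs-Euler solution on [0,T) staying in the packing band ρ_t(x)σ³ < η₀, every flow family
with the LLN at t = 0, every t < T and δ > 0 there is h₀ with: for cells B(x₀,h), h < h₀, and the
window [t, t + w_N], w_N = M/(σ²ρ_t(x₀)√θ_t(x₀)(N+1)^{1/3}) (M local kinetic time units), (SEL+ANG)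
for every continuous |F| ≤ 1 on V3³ the collision-sampled average of F(v_i⁻, v_j⁻, ω_ij) (incoming
velocities = left limits, ω = ε⁻¹·sepVec) over ordered collisions with x_i in the cell differs from
the flux-biased all-pairs average Σ_{i≠j in cell} ∫ F(v_i,v_j,ŷ)((v_i−v_j)·y)₋e^{−|y|²}dy
(normalised) by more than δ with probability → 0 as N → ∞; (RATE) the ordered collision count
differs from the Enskog prediction Σ_{i≠j in cell} πε_N²|v_i−v_j| w_N g_E(n_cell σ³)/|cell|, g_E(η)
= (Z(η)−1)/((2π/3)η) with Z = hsCompressibility and n_cell the empirical normalised density, by more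
than a factor δ with probability → 0. This is the (ANG)+(SEL)+rate input singled out by cards
limit-collision-measure-chaos / -/
@[route_item "route-AtomisticToContinuum-RingSparseCollisionForest"]
def ContactChaos : Prop :=
  ∃ η₀ : ℝ, 0 < η₀ ∧ ∀ (a₀ θ₀ : UnitAddTorus (Fin 3) → ℝ) (u₀ : UnitAddTorus (Fin 3) → EuclideanSpace ℝ (Fin 3)), Continuous a₀ → Continuous θ₀ → Continuous u₀ → (∀ x, 0 < a₀ x) → (∀ x, 0 < θ₀ x) → ∃ σ₀ : ℝ, 0 < σ₀ ∧ ∀ σ : ℝ, 0 < σ → σ < σ₀ → ∀ M : ℝ, 0 < M → ∀ (T : ℝ) (ρ θ : ℝ → UnitAddTorus (Fin 3) → ℝ) (u : ℝ → UnitAddTorus (Fin 3) → EuclideanSpace ℝ (Fin 3)), Literature.MathematicalPhysics.KineticTheory.IsHardSphereEulerSolution σ T ρ u θ → (∀ t ∈ Set.Ico 0 T, ∀ x, ρ t x * σ ^ 3 < η₀) → ∀ Φ : (N : ℕ) → Literature.Analysis.FluidPDE.HardSphereFlow (Literature.Analysis.FluidPDE.Torus.geometry (Fin 3)) (Literature.MathematicalPhysics.KineticTheory.hsDiameter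 σ N) (N + 1), Literature.MathematicalPhysics.KineticTheory.TendstoHydroFieldsAt (fun N => Literature.MathematicalPhysics.KineticTheory.localGibbsLaw σ a₀ u₀ θ₀ N (Φ N)) Φ ρ u θ 0 → ∀ t ∈ Set.Ico 0 T, ∀ δ : ℝ, 0 < δ → ∃ h₀ : ℝ, 0 < h₀ ∧ ∀ h : ℝ, 0 < h → h < h₀ → ∀ x₀ : UnitAddTorus (Fin 3), ∀ F : EuclideanSpace ℝ (Fin 3) → EuclideanSpace ℝ (Fin 3) → EuclideanSpace ℝ (Fin 3) → ℝ, Continuous (fun p : EuclideanSpace ℝ (Fin 3) × EuclideanSpace ℝ (Fin 3) × EuclideanSpace ℝ (Fin 3) => F p.1 p.2.1 p.2.2) → (∀ v v' ω, |F v v' ω| ≤ 1) → let w : ℕ → ℝ := fun N => M / (σ ^ 2 * (ρ t x₀ * Real.sqrt (θ t x₀) * ((N + 1 : ℕ) : ℝ) ^ (1 / 3 : ℝ))); let Sc := fun (N : ℕ) (z : Literature.Analysis.FluidPDE.Config (N + 1) (Fin 3) (UnitAddTorus (Fin 3))) (E : EuclideanSpace ℝ (Fin 3) → EuclideanSpace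 ℝ (Fin 3) → EuclideanSpace ℝ (Fin 3) → ℝ) => ∑ i : Fin (N + 1), ∑ j : Fin (N + 1), if i ≠ j then ∑ᶠ s ∈ {s : ℝ | s ∈ Set.Icc t (t + w N) ∧ (Φ N).flow s z ∈ Literature.Analysis.FluidPDE.contactSet (Literature.Analysis.FluidPDE.Torus.geometry (Fin 3)) (N + 1) (Literature.MathematicalPhysics.KineticTheory.hsDiameter σ N) i j ∧ Literature.Analysis.FluidPDE.Torus.euclidDist ((Φ N).flow s z i).1 x₀ < h}, E (Function.leftLim (fun s => (Φ N).flow s z) s i).2 (Function.leftLim (fun s => (Φ N).flow s z) s j).2 ((Literature.MathematicalPhysics.KineticTheory.hsDiameter σ N)⁻¹ • (Literature.Analysis.FluidPDE.Torus.geometry (Fin 3)).sepVec ((Φ N).flow s z i).1 ((Φ N).flow s z j).1) else 0; let Sr := fun (N : ℕ) (z : Literature.Analysis.FluidPDE.Config (N + 1) (Fin 3) (UnitAddTorus (Fin 3))) (E : EuclideanSpace ℝ (Fin 3) → EuclideanSpace ℝ (Fin 3) → EuclideanSpace ℝ (Fin 3) → ℝ) => ∑ i : Fin (N + 1), ∑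 j : Fin (N + 1), if i ≠ j ∧ Literature.Analysis.FluidPDE.Torus.euclidDist ((Φ N).flow t z i).1 x₀ < h ∧ Literature.Analysis.FluidPDE.Torus.euclidDist ((Φ N).flow t z j).1 x₀ < h then ∫ y : EuclideanSpace ℝ (Fin 3), E ((Φ N).flow t z i).2 ((Φ N).flow t z j).2 (‖y‖⁻¹ • y) * max 0 (-(inner ℝ (((Φ N).flow t z i).2 - ((Φ N).flow t z j).2) y)) * Real.exp (-‖y‖ ^ 2) else 0; let nl := fun (N : ℕ) (z : Literature.Analysis.FluidPDE.Config (N + 1) (Fin 3) (UnitAddTorus (Fin 3))) => (∑ i : Fin (N + 1), if Literature.Analysis.FluidPDE.Torus.euclidDist ((Φ N).flow t z i).1 x₀ < h then (1 : ℝ) else 0) / ((N + 1 : ℝ) * (4 / 3 * Real.pi * h ^ 3)); let Pr := fun (N : ℕ) (z : Literature.Analysis.FluidPDE.Config (N + 1) (Fin 3) (UnitAddTorus (Fin 3))) => ∑ i : Fin (N + 1), ∑ j : Fin (N + 1), if i ≠ j ∧ Literature.Analysis.FluidPDE.Torus.euclidDist ((Φ N).flow t z i).1 x₀ < h ∧ Literature.Analysis.FluidPDE.Torus.euclidDist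 ((Φ N).flow t z j).1 x₀ < h then Real.pi * (Literature.MathematicalPhysics.KineticTheory.hsDiameter σ N) ^ 2 * ‖((Φ N).flow t z i).2 - ((Φ N).flow t z j).2‖ * w N * ((Literature.MathematicalPhysics.KineticTheory.hsCompressibility (nl N z * σ ^ 3) - 1) / (2 * Real.pi / 3 * (nl N z * σ ^ 3))) / (4 / 3 * Real.pi * h ^ 3) else 0; Filter.Tendsto (fun N : ℕ => Literature.MathematicalPhysics.KineticTheory.localGibbsLaw σ a₀ u₀ θ₀ N (Φ N) {z | δ * Sc N z 1 * Sr N z 1 < |Sc N z F * Sr N z 1 - Sr N z F * Sc N z 1|}) Filter.atTop (nhds 0) ∧ Filter.Tendsto (fun N : ℕ => Literature.MathematicalPhysics.KineticTheory.localGibbsLaw σ a₀ u₀ θ₀ N (Φ N) {z | δ * Pr N z < |Sc N z 1 - Pr N z|}) Filter.atTop (nhds 0)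

/-- item stmt-AtomisticToContinuum-6615 · crux · rank 2 · closed · moot by None · by planner
why it might fail: A non-equilibrium bias in WHO recollides (compression/shear changing re-aiming geometry at the free-path scale) shifts the ring fraction at O(1)·(Kn-independent) if local equilibrium fails at scale ℓ; also needs h → 0 after N → ∞ (gradient mixing) and the equilibrium expectations to stabilise in N.
sources: AokiEtAl2015, PulvirentiSimonella2021, Dorfman1999, Cohen1967, BGSSCPAM2023
[crux] RING FRACTION TAKES ITS EQUILIBRIUM VALUE ALONG THE FLOW: ∃ η₀ > 0, for all profiles ∃ σ₀,
for σ < σ₀, M > 0, band-respecting classical solutions, flows with LLN at 0, t ∈ (0,T), δ > 0 ∃ h₀: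
for h < h₀, x₀ and every comparison flow family Ψ of N+1 spheres with diameter parameter σ' =
σρ_t(x₀)^{1/3} (same reduced density as the cell), P(|Z_ring − r_E(N)·Z_coll| > δ Z_coll) → 0, where
Z_coll/Z_ring count ordered (ring) collisions in cell×window (M-rings: backward clusters over (s −
w_N, s) intersect; clusters = time-respecting collision chains, AokiEtAl2015 §1) and r_E(N) =
E_Q[Z'_ring]/E_Q[Z'_coll] is the ring fraction of the HOMOGENEOUS equilibrium system (canonical law,
density 1, temperature θ_t(x₀), diameter σ', window [0, w'_N] with the same number M of kinetic
units). 'Rings out of equilibrium are as frequent as rings in equilibrium at the same local state' —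
the quantitative half of the certificate, MD-measurable. [difficulty: XL] -/
@[route_item "route-AtomisticToContinuum-RingSparseCollisionForest"]
def RingDensityLaw : Prop :=
  ∃ η₀ : ℝ, 0 < η₀ ∧ ∀ (a₀ θ₀ : UnitAddTorus (Fin 3) → ℝ) (u₀ : UnitAddTorus (Fin 3) → EuclideanSpace ℝ (Fin 3)), Continuous a₀ → Continuous θ₀ → Continuous u₀ → (∀ x, 0 < a₀ x) → (∀ x, 0 < θ₀ x) → ∃ σ₀ : ℝ, 0 < σ₀ ∧ ∀ σ : ℝ, 0 < σ → σ < σ₀ → ∀ M : ℝ, 0 < M → ∀ (T : ℝ) (ρ θ : ℝ → UnitAddTorus (Fin 3) → ℝ) (u : ℝ → UnitAddTorus (Fin 3) → EuclideanSpace ℝ (Fin 3)), Literature.MathematicalPhysics.KineticTheory.IsHardSphereEulerSolution σ T ρ u θ → (∀ t ∈ Set.Ico 0 T, ∀ x, ρ t x * σ ^ 3 < η₀) → ∀ Φ : (N : ℕ) → Literature.Analysis.FluidPDE.HardSphereFlow (Literature.Analysis.FluidPDE.Torus.geometry (Fin 3)) (Literature.MathematicalPhysics.KineticTheory.hsDiameter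 σ N) (N + 1), Literature.MathematicalPhysics.KineticTheory.TendstoHydroFieldsAt (fun N => Literature.MathematicalPhysics.KineticTheory.localGibbsLaw σ a₀ u₀ θ₀ N (Φ N)) Φ ρ u θ 0 → ∀ t ∈ Set.Ioo 0 T, ∀ δ : ℝ, 0 < δ → ∃ h₀ : ℝ, 0 < h₀ ∧ ∀ h : ℝ, 0 < h → h < h₀ → ∀ x₀ : UnitAddTorus (Fin 3), ∀ Ψ : (N : ℕ) → Literature.Analysis.FluidPDE.HardSphereFlow (Literature.Analysis.FluidPDE.Torus.geometry (Fin 3)) (Literature.MathematicalPhysics.KineticTheory.hsDiameter (σ * ρ t x₀ ^ (1 / 3 : ℝ)) N) (N + 1), let w : ℕ → ℝ := fun N => M / (σ ^ 2 * (ρ t x₀ * Real.sqrt (θ t x₀) * ((N + 1 : ℕ) : ℝ) ^ (1 / 3 : ℝ))); let w' : ℕ → ℝ := fun N => M / ((σ * ρ t x₀ ^ (1 / 3 : ℝ)) ^ 2 * (Real.sqrt (θ t x₀) * ((N + 1 : ℕ) : ℝ) ^ (1 / 3 : ℝ))); let Tc := fun (N : ℕ) (ε : ℝ) (γ : ℝ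 → Literature.Analysis.FluidPDE.Config (N + 1) (Fin 3) (UnitAddTorus (Fin 3))) (a ℓ r : ℝ) (i j : Fin (N + 1)) => {s : ℝ | s ∈ Set.Icc a (a + ℓ) ∧ γ s ∈ Literature.Analysis.FluidPDE.contactSet (Literature.Analysis.FluidPDE.Torus.geometry (Fin 3)) (N + 1) ε i j ∧ Literature.Analysis.FluidPDE.Torus.euclidDist (γ s i).1 x₀ < r}; let Bc := fun (N : ℕ) (ε : ℝ) (γ : ℝ → Literature.Analysis.FluidPDE.Config (N + 1) (Fin 3) (UnitAddTorus (Fin 3))) (a b : ℝ) (i : Fin (N + 1)) => {k : Fin (N + 1) | ∃ (m : ℕ) (p : Fin (m + 1) → Fin (N + 1)) (τ : Fin m → ℝ), p 0 = i ∧ p (Fin.last m) = k ∧ StrictAnti τ ∧ ∀ l : Fin m, τ l ∈ Set.Ico a b ∧ γ (τ l) ∈ Literature.Analysis.FluidPDE.contactSet (Literature.Analysis.FluidPDE.Torus.geometry (Fin 3)) (N + 1) ε (p l.castSucc) (p l.succ)}; let Zc := fun (N : ℕ) (ε : ℝ) (γ : ℝ → Literature.Analysis.FluidPDE.Config (N +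 1) (Fin 3) (UnitAddTorus (Fin 3))) (a ℓ r : ℝ) => ∑ i : Fin (N + 1), ∑ j : Fin (N + 1), if i ≠ j then ∑ᶠ s ∈ Tc N ε γ a ℓ r i j, (1 : ℝ) else 0; let Zr := fun (N : ℕ) (ε : ℝ) (γ : ℝ → Literature.Analysis.FluidPDE.Config (N + 1) (Fin 3) (UnitAddTorus (Fin 3))) (a ℓ r : ℝ) => ∑ i : Fin (N + 1), ∑ j : Fin (N + 1), if i ≠ j then ∑ᶠ s ∈ Tc N ε γ a ℓ r i j, Set.indicator {s' : ℝ | ∃ k, k ∈ Bc N ε γ (s' - ℓ) s' i ∧ k ∈ Bc N ε γ (s' - ℓ) s' j} 1 s else 0; let rE : ℕ → ℝ := fun N => (∫ z, Zr N (Literature.MathematicalPhysics.KineticTheory.hsDiameter (σ * ρ t x₀ ^ (1 / 3 : ℝ)) N) (fun s => (Ψ N).flow s z) 0 (w' N) 2 ∂Literature.MathematicalPhysics.KineticTheory.localGibbsLaw (σ * ρ t x₀ ^ (1 / 3 : ℝ)) 1 0 (fun _ => θ t x₀) N (Ψ N)) / (∫ z, Zc N (Literature.MathematicalPhysics.KineticTheory.hsDiameter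 (σ * ρ t x₀ ^ (1 / 3 : ℝ)) N) (fun s => (Ψ N).flow s z) 0 (w' N) 2 ∂Literature.MathematicalPhysics.KineticTheory.localGibbsLaw (σ * ρ t x₀ ^ (1 / 3 : ℝ)) 1 0 (fun _ => θ t x₀) N (Ψ N)); Filter.Tendsto (fun N : ℕ => Literature.MathematicalPhysics.KineticTheory.localGibbsLaw σ a₀ u₀ θ₀ N (Φ N) {z | δ * Zc N (Literature.MathematicalPhysics.KineticTheory.hsDiameter σ N) (fun s => (Φ N).flow s z) t (w N) h < |Zr N (Literature.MathematicalPhysics.KineticTheory.hsDiameter σ N) (fun s => (Φ N).flow s z) t (w N) h - rE N * Zc N (Literature.MathematicalPhysics.KineticTheory.hsDiameter σ N) (fun s => (Φ N).flow s z) t (w N) h|}) Filter.atTop (nhds 0)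

/-- item stmt-AtomisticToContinuum-6616 · crux · rank 3 · closed · moot by None · by planner
why it might fail: Large data: the transfer constant e^{ΛN} of the initial tilt beats the extensive equilibrium rate e^{−c(δ,M)N} unless the amplitude is small; clusters grow like e^{C M} (AokiEtAl2015 Thm 1) so η(M,δ) ~ δe^{−2CM} is tiny; a flow-generated excess of recollisions at fixed packing would refute it.
sources: AokiEtAl2015, PulvirentiSimonella2021, Janson2004, KipnisLandim1999, BGSSAnnals2023
[crux] TREE-LIKENESS OF NON-EQUILIBRIUM COLLISION HISTORIES (card B1, all amplitudes): for every
window multiplier M > 0 and δ > 0 there is a packing threshold η(M,δ) > 0 such that for all profiles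
∃ σ₀, for σ < σ₀, every classical solution with ρ_t(x)σ³ < η on [0,T), flows with LLN at 0, t ∈
(0,T), h > 0, x₀: P(Z_ring > δ·Z_coll in B(x₀,h) × [t, t+w_N]) → 0 as N → ∞ (w_N = M local kinetic
units as in ContactChaos). Small data: EquilibriumRingLD + TiltTransfer + HomogeneousInvariance give
it for ALL times (support SmallDataRingSparsity); large data: zoom (card first-failure-blowup) or a
super-extensive LD for the time-integrated ring count (card spacetime-superextensive-ld).
[difficulty: L] -/
@[route_item "route-AtomisticToContinuum-RingSparseCollisionForest"]
def RingSparsity : Prop :=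
  ∀ M : ℝ, 0 < M → ∀ δ : ℝ, 0 < δ → ∃ η : ℝ, 0 < η ∧ ∀ (a₀ θ₀ : UnitAddTorus (Fin 3) → ℝ) (u₀ : UnitAddTorus (Fin 3) → EuclideanSpace ℝ (Fin 3)), Continuous a₀ → Continuous θ₀ → Continuous u₀ → (∀ x, 0 < a₀ x) → (∀ x, 0 < θ₀ x) → ∃ σ₀ : ℝ, 0 < σ₀ ∧ ∀ σ : ℝ, 0 < σ → σ < σ₀ → ∀ (T : ℝ) (ρ θ : ℝ → UnitAddTorus (Fin 3) → ℝ) (u : ℝ → UnitAddTorus (Fin 3) → EuclideanSpace ℝ (Fin 3)), Literature.MathematicalPhysics.KineticTheory.IsHardSphereEulerSolution σ T ρ u θ → (∀ t ∈ Set.Ico 0 T, ∀ x, ρ t x * σ ^ 3 < η) → ∀ Φ : (N : ℕ) → Literature.Analysis.FluidPDE.HardSphereFlow (Literature.Analysis.FluidPDE.Torus.geometry (Fin 3)) (Literature.MathematicalPhysics.KineticTheory.hsDiameter σ N) (N + 1), Literature.MathematicalPhysics.KineticTheory.TendstoHydroFieldsAt (fun N => Literature.MathematicalPhysics.KineticTheory.localGibbsLaw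 σ a₀ u₀ θ₀ N (Φ N)) Φ ρ u θ 0 → ∀ t ∈ Set.Ioo 0 T, ∀ h : ℝ, 0 < h → ∀ x₀ : UnitAddTorus (Fin 3), let w : ℕ → ℝ := fun N => M / (σ ^ 2 * (ρ t x₀ * Real.sqrt (θ t x₀) * ((N + 1 : ℕ) : ℝ) ^ (1 / 3 : ℝ))); let Tc := fun (N : ℕ) (ε : ℝ) (γ : ℝ → Literature.Analysis.FluidPDE.Config (N + 1) (Fin 3) (UnitAddTorus (Fin 3))) (a ℓ r : ℝ) (i j : Fin (N + 1)) => {s : ℝ | s ∈ Set.Icc a (a + ℓ) ∧ γ s ∈ Literature.Analysis.FluidPDE.contactSet (Literature.Analysis.FluidPDE.Torus.geometry (Fin 3)) (N + 1) ε i j ∧ Literature.Analysis.FluidPDE.Torus.euclidDist (γ s i).1 x₀ < r}; let Bc := fun (N : ℕ) (ε : ℝ) (γ : ℝ → Literature.Analysis.FluidPDE.Config (N + 1) (Fin 3) (UnitAddTorus (Fin 3))) (a b : ℝ) (i : Fin (N + 1)) => {k : Fin (N + 1) | ∃ (m : ℕ) (p : Fin (m + 1) → Fin (N + 1)) (τ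 : Fin m → ℝ), p 0 = i ∧ p (Fin.last m) = k ∧ StrictAnti τ ∧ ∀ l : Fin m, τ l ∈ Set.Ico a b ∧ γ (τ l) ∈ Literature.Analysis.FluidPDE.contactSet (Literature.Analysis.FluidPDE.Torus.geometry (Fin 3)) (N + 1) ε (p l.castSucc) (p l.succ)}; let Zc := fun (N : ℕ) (ε : ℝ) (γ : ℝ → Literature.Analysis.FluidPDE.Config (N + 1) (Fin 3) (UnitAddTorus (Fin 3))) (a ℓ r : ℝ) => ∑ i : Fin (N + 1), ∑ j : Fin (N + 1), if i ≠ j then ∑ᶠ s ∈ Tc N ε γ a ℓ r i j, (1 : ℝ) else 0; let Zr := fun (N : ℕ) (ε : ℝ) (γ : ℝ → Literature.Analysis.FluidPDE.Config (N + 1) (Fin 3) (UnitAddTorus (Fin 3))) (a ℓ r : ℝ) => ∑ i : Fin (N + 1), ∑ j : Fin (N + 1), if i ≠ j then ∑ᶠ s ∈ Tc N ε γ a ℓ r i j, Set.indicator {s' : ℝ | ∃ k, k ∈ Bc N ε γ (s' - ℓ) s' i ∧ k ∈ Bc N ε γ (s' - ℓ) s' j} 1 s else 0; Filter.Tendsto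 (fun N : ℕ => Literature.MathematicalPhysics.KineticTheory.localGibbsLaw σ a₀ u₀ θ₀ N (Φ N) {z | δ * Zc N (Literature.MathematicalPhysics.KineticTheory.hsDiameter σ N) (fun s => (Φ N).flow s z) t (w N) h < Zr N (Literature.MathematicalPhysics.KineticTheory.hsDiameter σ N) (fun s => (Φ N).flow s z) t (w N) h}) Filter.atTop (nhds 0)

/-- item stmt-AtomisticToContinuum-6617 · crux · rank 4 · closed · moot by None · by planner
why it might fail: No Cauchy–Schwarz/Gram identity is known for time-ordered collision motifs: a velocity-correlated state with EQUILIBRIUM ring density may exist (e.g. shear-aligned pairs), making the certificate blind; the far-field input (off-contact k-body LE) is itself open at fixed σ.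
sources: ChungGrahamWilson1989, ChungGraham2002, AokiEtAl2015, PulvirentiSimonella2016, BGSSAnnals2023, Lutsko1996
[crux] RING DENSITY CERTIFIES CHAOS (card's programme form, CGW-type rigidity for time-ordered
collision forests): in the sparse regime (RingSparsity) equality of the window ring fraction with
its equilibrium value at the local state (RingDensityLaw) forces the empirical Stosszahlansatz
(ContactChaos). Intended mechanism: ancestry lemma (at fresh collisions incoming data come from
disjoint backward clusters, so correlation can only be inherited from the mesoscopic far field at
the window start) + 'excess correlation forces excess/deficient short cycles' (codegree ⇒ edge
uniformity, ChungGrahamWilson1989 Thm 1 analogue; sparse setting ChungGraham2002) +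
rings-in-a-local-equilibrium-medium for the ring minority; flag-algebra/SDP certificates over motifs
with ≤ 4 collisions as the systematic search tool. [deps: RingSparsity, RingDensityLaw,
ContactChaos] [difficulty: open-problem] -/
@[route_item "route-AtomisticToContinuum-RingSparseCollisionForest"]
def RingCertificate : Prop :=
  RingSparsity → RingDensityLaw → ContactChaos

/-- item stmt-AtomisticToContinuum-6618 · crux · rank 5 · closed · moot by None · by planner
why it might fail: Chaos tested by bounded F in shrinking cells may be too weak for a quantitative H-theorem on EMPIRICAL measures (atomic measures have no entropy: smoothing + Cercignani-type production bounds, DesvillettesVillani2005); mv limits need the exact hs entropy inequality.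
sources: Resibois1978, BrezinaFeireisl2018, Dafermos1979, DesvillettesVillani2005, Spohn1991, doi:10.1007/bf01029065
[crux] EMPIRICAL ENSKOG CHAOS CLOSES hs-EULER IN THE PACKING BAND: ContactChaos → HydroLimitInBand,
the packing-guarded conjunct of route ImplosionLoophole (stmt-AtomisticToContinuum-3093, inlined
verbatim as the consequent: ∃ η₀ > 0 ∀ profiles ∃ σ₀ ∀ σ < σ₀ ∀ classical solutions with ρ_t(x)σ³ <
η₀ on [0,T) ∀ flows, LLN at 0 ⇒ LLN at every t < T). Intended proof: Bogolyubov's exact empirical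
identity for (μ^N, collision measure) (doi:10.1007/bf01029065) + SEL/ANG/RATE ⇒ empirical
revised-Enskog structure in every cell/window ⇒ H-theorem (Resibois1978) ⇒ cell velocity laws relax
to local Maxwellians within O(1) kinetic times and entropy production ≥ 0 ⇒ kinetic + collisional
fluxes = (ρu⊗u + ρθZ(ρσ³)𝟙, (E+p)u) and the hs entropy inequality for limit points ⇒ dissipative
measure-valued solution ⇒ relative-entropy weak–strong uniqueness (Dafermos1979,
BrezinaFeireisl2018, HsEntropyConvex 0817) ⇒ fields converge for t < T; velocity tails by transfer
of Gaussian moments against the invariant law (TiltTransfer-type bound). [deps: ContactChaos]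
[difficulty: XL] -/
@[route_item "route-AtomisticToContinuum-RingSparseCollisionForest"]
def ChaosClosure : Prop :=
  ContactChaos → ∃ η₀ : ℝ, 0 < η₀ ∧ ∀ (a₀ θ₀ : Literature.MathematicalPhysics.KineticTheory.T3 → ℝ) (u₀ : Literature.MathematicalPhysics.KineticTheory.T3 → Literature.MathematicalPhysics.KineticTheory.V3), Continuous a₀ → Continuous θ₀ → Continuous u₀ → (∀ x, 0 < a₀ x) → (∀ x, 0 < θ₀ x) → ∃ σ₀ : ℝ, 0 < σ₀ ∧ ∀ σ : ℝ, 0 < σ → σ < σ₀ → ∀ (T : ℝ) (ρ θ : ℝ → Literature.MathematicalPhysics.KineticTheory.T3 → ℝ) (u : ℝ → Literature.MathematicalPhysics.KineticTheory.T3 → Literature.MathematicalPhysics.KineticTheory.V3), Literature.MathematicalPhysics.KineticTheory.IsHardSphereEulerSolution σ T ρ u θ → (∀ t ∈ Set.Ico 0 T, ∀ x, ρ t x * σ ^ 3 < η₀) → ∀ Φ : (N : ℕ) → Literature.Analysis.FluidPDE.HardSphereFlow (Literature.Analysis.FluidPDE.Torus.geometry (Fin 3)) (Literature.MathematicalPhysics.KineticTheory.hsDiameter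 σ N) (N + 1), Literature.MathematicalPhysics.KineticTheory.TendstoHydroFieldsAt (fun N => Literature.MathematicalPhysics.KineticTheory.localGibbsLaw σ a₀ u₀ θ₀ N (Φ N)) Φ ρ u θ 0 → ∀ t ∈ Set.Ico 0 T, Literature.MathematicalPhysics.KineticTheory.TendstoHydroFieldsAt (fun N => Literature.MathematicalPhysics.KineticTheory.localGibbsLaw σ a₀ u₀ θ₀ N (Φ N)) Φ ρ u θ t

/-- item stmt-AtomisticToContinuum-3073 · support · rank 9 · closed · moot by None · by planner
[support] the canonical law with CONSTANT profiles (c, ū, θ̄) is invariant under every hard-sphere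
flow, lawAt Φ p t = p: its density 1_D Π_i M_{ū,θ̄}(v_i)/Z is a function of kinetic energy and total
momentum; Liouville preservation (HardSphereFlow.measurePreserving), energy conservation
(IsHardSphereTrajectory.configEnergy_eq_holds), momentum conservation (configMomentum_freeFlight /
configMomentum_collidePair along isTrajectory), invariance of the good set. Gives E_{p_0}[F_t] =
E_{p_0}[F_0] at the κ = 0 end of the homotopy; rests on PROVED cone facts. [difficulty:
provable-now] -/
@[route_item "route-AtomisticToContinuum-RingSparseCollisionForest"]
def HomogeneousInvariance : Prop :=
  ∀ (σ c θc : ℝ) (uc : Literature.MathematicalPhysics.KineticTheory.V3), 0 < σ → 0 < c → 0 < θc → ∀ (N : ℕ) (Φ : Literature.Analysis.FluidPDE.HardSphereFlow (Literature.Analysis.FluidPDE.Torus.geometry (Fin 3)) (Literature.MathematicalPhysics.KineticTheory.hsDiameter σ N) (N + 1)) (t : ℝ), Φ.lawAt (Literature.MathematicalPhysics.KineticTheory.localGibbsLaw σ (fun _ => c) (fun _ => uc) (fun _ => θc) N Φ) t = Literature.MathematicalPhysics.KineticTheory.localGibbsLaw σ (fun _ => c) (fun _ => uc) (fun _ =>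 θc) N Φ

/-- item stmt-AtomisticToContinuum-6619 · support · rank 9 · closed · moot by None · by planner
sources: Janson2004, KipnisLandim1999, Ruelle1969, AokiEtAl2015
[support] EXTENSIVE EQUILIBRIUM LARGE DEVIATIONS FOR THE RING FRACTION (card B1(a)): for θc > 0, M >
0, δ > 0 ∃ σ₀, for σ < σ₀ and h > 0 ∃ C > 0 such that under the homogeneous canonical law Q_N
(activity 1, velocity 0, temperature θc) of N+1 spheres, for every t, x₀, flow family and N:
Q_N(|Z_ring − r_E(N) Z_coll| > δ Z_coll in B(x₀,h) × [t, t+w_N]) ≤ C e^{−(N+1)/C}, r_E(N) =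
E_Q[Z_ring]/E_Q[Z_coll], w_N = M/(σ²√θc (N+1)^{1/3}). Proof sketch: velocity truncation (Gaussian
tails), spatial near-independence of mesoscopic sub-cells over a microscopic window +
dependency-graph Bernstein/Janson bound inside, canonical-constraint decoupling; stationarity makes
C independent of t (HomogeneousInvariance). [difficulty: M] -/
@[route_item "route-AtomisticToContinuum-RingSparseCollisionForest"]
def EquilibriumRingLD : Prop :=
  ∀ θc : ℝ, 0 < θc → ∀ M : ℝ, 0 < M → ∀ δ : ℝ, 0 < δ → ∃ σ₀ : ℝ, 0 < σ₀ ∧ ∀ σ : ℝ, 0 < σ → σ < σ₀ → ∀ h : ℝ, 0 < h → ∃ C : ℝ, 0 < C ∧ ∀ (t : ℝ) (x₀ : UnitAddTorus (Fin 3)) (Φ : (N : ℕ) → Literature.Analysis.FluidPDE.HardSphereFlow (Literature.Analysis.FluidPDE.Torus.geometry (Fin 3)) (Literature.MathematicalPhysics.KineticTheory.hsDiameter σ N) (N + 1)), let w : ℕ → ℝ := fun N => M / (σ ^ 2 * (Real.sqrt (θc) * ((N + 1 : ℕ) : ℝ) ^ (1 / 3 : ℝ))); let Tc := fun (N : ℕ)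 (ε : ℝ) (γ : ℝ → Literature.Analysis.FluidPDE.Config (N + 1) (Fin 3) (UnitAddTorus (Fin 3))) (a ℓ r : ℝ) (i j : Fin (N + 1)) => {s : ℝ | s ∈ Set.Icc a (a + ℓ) ∧ γ s ∈ Literature.Analysis.FluidPDE.contactSet (Literature.Analysis.FluidPDE.Torus.geometry (Fin 3)) (N + 1) ε i j ∧ Literature.Analysis.FluidPDE.Torus.euclidDist (γ s i).1 x₀ < r}; let Bc := fun (N : ℕ) (ε : ℝ) (γ : ℝ → Literature.Analysis.FluidPDE.Config (N + 1) (Fin 3) (UnitAddTorus (Fin 3))) (a b : ℝ) (i : Fin (N + 1)) => {k : Fin (N + 1) | ∃ (m : ℕ) (p : Fin (m + 1) → Fin (N + 1)) (τ : Fin m → ℝ), p 0 = i ∧ p (Fin.last m) = k ∧ StrictAnti τ ∧ ∀ l : Fin m, τ l ∈ Set.Ico a b ∧ γ (τ l) ∈ Literature.Analysis.FluidPDE.contactSet (Literature.Analysis.FluidPDE.Torus.geometry (Fin 3)) (N + 1) ε (p l.castSucc) (p l.succ)}; let Zc := fun (N : ℕ) (ε : ℝ) (γ : ℝ → Literature.Analysis.FluidPDE.Config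 (N + 1) (Fin 3) (UnitAddTorus (Fin 3))) (a ℓ r : ℝ) => ∑ i : Fin (N + 1), ∑ j : Fin (N + 1), if i ≠ j then ∑ᶠ s ∈ Tc N ε γ a ℓ r i j, (1 : ℝ) else 0; let Zr := fun (N : ℕ) (ε : ℝ) (γ : ℝ → Literature.Analysis.FluidPDE.Config (N + 1) (Fin 3) (UnitAddTorus (Fin 3))) (a ℓ r : ℝ) => ∑ i : Fin (N + 1), ∑ j : Fin (N + 1), if i ≠ j then ∑ᶠ s ∈ Tc N ε γ a ℓ r i j, Set.indicator {s' : ℝ | ∃ k, k ∈ Bc N ε γ (s' - ℓ) s' i ∧ k ∈ Bc N ε γ (s' - ℓ) s' j} 1 s else 0; let rE : ℕ → ℝ := fun N => (∫ z, Zr N (Literature.MathematicalPhysics.KineticTheory.hsDiameter σ N) (fun s => (Φ N).flow s z) t (w N) h ∂Literature.MathematicalPhysics.KineticTheory.localGibbsLaw σ 1 0 (fun _ => θc) N (Φ N)) / (∫ z, Zc N (Literature.MathematicalPhysics.KineticTheory.hsDiameter σ N) (fun s => (Φ N).flow s z) t (w N) h ∂Literature.MathematicalPhysics.KineticTheory.localGibbsLaw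 σ 1 0 (fun _ => θc) N (Φ N)); ∀ N : ℕ, Literature.MathematicalPhysics.KineticTheory.localGibbsLaw σ 1 0 (fun _ => θc) N (Φ N) {z | δ * Zc N (Literature.MathematicalPhysics.KineticTheory.hsDiameter σ N) (fun s => (Φ N).flow s z) t (w N) h < |Zr N (Literature.MathematicalPhysics.KineticTheory.hsDiameter σ N) (fun s => (Φ N).flow s z) t (w N) h - rE N * Zc N (Literature.MathematicalPhysics.KineticTheory.hsDiameter σ N) (fun s => (Φ N).flow s z) t (w N) h|} ≤ ENNReal.ofReal (C * Real.exp (-(C⁻¹ * (N + 1))))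

/-- item stmt-AtomisticToContinuum-6620 · support · rank 9 · closed · moot by None · by planner
sources: KipnisLandim1999, Spohn1991, GST2013
[support] CAUCHY–SCHWARZ TRANSFER AGAINST THE INVARIANT LAW (card B4): for σ > 0, continuous
positive profiles (a₀,u₀,θ₀) and θc with θ₀ < 2θc pointwise there is Λ such that for all N, flows Φ,
times t and measurable B: (lawAt Φ P_N t)(B) ≤ e^{Λ(N+1)} · Q_N(B)^{1/2}, P_N = localGibbsLaw σ a₀
u₀ θ₀ N Φ, Q_N = homogeneous law (1, 0, θc). Proof: P_t(B) = ∫ 1_B∘Φ_t · (dP/dQ) dQ ≤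
Q(Φ_t⁻¹B)^{1/2} ‖dP/dQ‖_{L²(Q)}, invariance of Q (HomogeneousInvariance), ‖dP/dQ‖² ≤
(Z_Q/Z_P²)·K^{N+1} with K = sup_x ∫ (a₀M_{u₀,θ₀})²/M_{0,θc} dv < ∞ iff θ₀ < 2θc, Z_P ≥ (inf a₀ ·
c_v)^{N+1} Z_Q; both sides vanish when the partition function does. [difficulty: provable-now] -/
@[route_item "route-AtomisticToContinuum-RingSparseCollisionForest"]
def TiltTransfer : Prop :=
  ∀ σ : ℝ, 0 < σ → ∀ (a₀ θ₀ : UnitAddTorus (Fin 3) → ℝ) (u₀ : UnitAddTorus (Fin 3) → EuclideanSpace ℝ (Fin 3)) (θc : ℝ), Continuous a₀ → Continuous θ₀ → Continuous u₀ → (∀ x, 0 < a₀ x) → (∀ x, 0 < θ₀ x) → (∀ x, θ₀ x < 2 * θc) → ∃ Λ : ℝ, ∀ (N : ℕ) (Φ : Literature.Analysis.FluidPDE.HardSphereFlow (Literature.Analysis.FluidPDE.Torus.geometry (Fin 3)) (Literature.MathematicalPhysics.KineticTheory.hsDiameter σ N) (N + 1)) (t : ℝ) (B : Set (Literature.Analysis.FluidPDE.Config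 (N + 1) (Fin 3) (UnitAddTorus (Fin 3)))), MeasurableSet B → (Φ.lawAt (Literature.MathematicalPhysics.KineticTheory.localGibbsLaw σ a₀ u₀ θ₀ N Φ) t) B ≤ ENNReal.ofReal (Real.exp (Λ * (N + 1))) * (Literature.MathematicalPhysics.KineticTheory.localGibbsLaw σ 1 0 (fun _ => θc) N Φ B) ^ (1 / 2 : ℝ)

/-- item stmt-AtomisticToContinuum-6621 · support · rank 9 · closed · moot by None · by planner
sources: Janson2004, KipnisLandim1999, AokiEtAl2015, Dorfman1999
[support] SMALL-DATA TREE-LIKENESS FOR ALL TIMES (card B1(a)+(b), the concrete deliverable): for c,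
θc > 0, M > 0, δ > 0 ∃ σ₀, for σ < σ₀ ∃ η₀ > 0 such that for continuous positive profiles within η₀
of the constants (|a₀−c|, ‖u₀‖, |θ₀−θc| ≤ η₀), every flow family, EVERY time t ∈ ℝ, h > 0, x₀:
P_N(Z_ring > δ Z_coll in B(x₀,h) × [t, t+w_N]) → 0, w_N = M/(σ²√θc(N+1)^{1/3}). From
EquilibriumRingLD (+ smallness of r_E: r_E(N) ≤ δ/2 for σ < σ₀(M,δ), an Enskog-level three-body
re-aiming computation, Dorfman1999 §16) and TiltTransfer with Λ(η₀) < 1/(2C): a rigorous dynamical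
statement at fixed density valid for all macroscopic times with no mixing input. [difficulty: M] -/
@[route_item "route-AtomisticToContinuum-RingSparseCollisionForest"]
def SmallDataRingSparsity : Prop :=
  ∀ (c θc : ℝ), 0 < c → 0 < θc → ∀ M : ℝ, 0 < M → ∀ δ : ℝ, 0 < δ → ∃ σ₀ : ℝ, 0 < σ₀ ∧ ∀ σ : ℝ, 0 < σ → σ < σ₀ → ∃ η₀ : ℝ, 0 < η₀ ∧ ∀ (a₀ θ₀ : UnitAddTorus (Fin 3) → ℝ) (u₀ : UnitAddTorus (Fin 3) → EuclideanSpace ℝ (Fin 3)), Continuous a₀ → Continuous θ₀ → Continuous u₀ → (∀ x, 0 < a₀ x) → (∀ x, 0 < θ₀ x) → (∀ x, |a₀ x - c| ≤ η₀ ∧ ‖u₀ x‖ ≤ η₀ ∧ |θ₀ x - θc| ≤ η₀) → ∀ Φ : (N : ℕ) → Literature.Analysis.FluidPDE.HardSphereFlow (Literature.Analysis.FluidPDE.Torus.geometry (Fin 3)) (Literature.MathematicalPhysics.KineticTheory.hsDiameter σ N) (N + 1), ∀ (t : ℝ) (h : ℝ), 0 < h → ∀ x₀ : UnitAddTorus (Fin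 3), let w : ℕ → ℝ := fun N => M / (σ ^ 2 * (Real.sqrt (θc) * ((N + 1 : ℕ) : ℝ) ^ (1 / 3 : ℝ))); let Tc := fun (N : ℕ) (ε : ℝ) (γ : ℝ → Literature.Analysis.FluidPDE.Config (N + 1) (Fin 3) (UnitAddTorus (Fin 3))) (a ℓ r : ℝ) (i j : Fin (N + 1)) => {s : ℝ | s ∈ Set.Icc a (a + ℓ) ∧ γ s ∈ Literature.Analysis.FluidPDE.contactSet (Literature.Analysis.FluidPDE.Torus.geometry (Fin 3)) (N + 1) ε i j ∧ Literature.Analysis.FluidPDE.Torus.euclidDist (γ s i).1 x₀ < r}; let Bc := fun (N : ℕ) (ε : ℝ) (γ : ℝ → Literature.Analysis.FluidPDE.Config (N + 1) (Fin 3) (UnitAddTorus (Fin 3))) (a b : ℝ) (i : Fin (N + 1)) => {k : Fin (N + 1) | ∃ (m : ℕ) (p : Fin (m + 1) → Fin (N + 1)) (τ : Fin m → ℝ), p 0 = i ∧ p (Fin.last m) = k ∧ StrictAnti τ ∧ ∀ l : Fin m, τ l ∈ Set.Ico a b ∧ γ (τ l) ∈ Literature.Analysis.FluidPDE.contactSet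 (Literature.Analysis.FluidPDE.Torus.geometry (Fin 3)) (N + 1) ε (p l.castSucc) (p l.succ)}; let Zc := fun (N : ℕ) (ε : ℝ) (γ : ℝ → Literature.Analysis.FluidPDE.Config (N + 1) (Fin 3) (UnitAddTorus (Fin 3))) (a ℓ r : ℝ) => ∑ i : Fin (N + 1), ∑ j : Fin (N + 1), if i ≠ j then ∑ᶠ s ∈ Tc N ε γ a ℓ r i j, (1 : ℝ) else 0; let Zr := fun (N : ℕ) (ε : ℝ) (γ : ℝ → Literature.Analysis.FluidPDE.Config (N + 1) (Fin 3) (UnitAddTorus (Fin 3))) (a ℓ r : ℝ) => ∑ i : Fin (N + 1), ∑ j : Fin (N + 1), if i ≠ j then ∑ᶠ s ∈ Tc N ε γ a ℓ r i j, Set.indicator {s' : ℝ | ∃ k, k ∈ Bc N ε γ (s' - ℓ) s' i ∧ k ∈ Bc N ε γ (s' - ℓ) s' j} 1 s else 0; Filter.Tendsto (fun N : ℕ => Literature.MathematicalPhysics.KineticTheory.localGibbsLaw σ a₀ u₀ θ₀ N (Φ N) {z | δ * Zc N (Literature.MathematicalPhysics.KineticTheory.hsDiameter σ N) (fun s =>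 (Φ N).flow s z) t (w N) h < Zr N (Literature.MathematicalPhysics.KineticTheory.hsDiameter σ N) (fun s => (Φ N).flow s z) t (w N) h}) Filter.atTop (nhds 0)

-- TODO item stmt-AtomisticToContinuum-6622 · assembly · rank 1 · closed · moot by None · by planner — BLOCKED: missing decl(s) DiluteSelfConsistency; restate via `ledger route edit` once they land:
--   def Assembly : Prop := RingSparsity → RingDensityLaw → RingCertificate → ChaosClosure → DiluteSelfConsistency → Literature.MathematicalPhysics.KineticTheory.HydrodynamicLimit

end Summit.AtomisticToContinuum.HydrodynamicLimit.Theses.RingSparseCollisionForest
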